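import Summits.QuantumAdvantage.QuantumAdvantage.Theorems.FanInRootCollapseB
import Summits.QuantumAdvantage.QuantumAdvantage.Theorems.FanInRootSeeds2

/-!
# FanInRoot (8/11): QUADRATIC COMBS (three teeth determine the comb — Vandermonde) and the UNCONDITIONAL `Θ(n^{2/3})` fan-in rung `noPerfectFanInAll_twoThirdsRoot`
-/

set_option linter.dupNamespace false -- D-0017: single-problem summit ⇒ `QuantumAdvantage.QuantumAdvantage` by design

namespace Summit.QuantumAdvantage.QuantumAdvantage.Theorems.FanInRoot

open Finset
open Summit.QuantumAdvantage.AdviceFreeQNC0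
open Literature.Computability.QuantumComplexity
open Literature.Computability.QuantumComplexity.RingHLF
open Literature.Computability.MetaComplexity
open scoped Classical

/-! ### §6h QUADRATIC COMBS (Vandermonde counting): an UNCONDITIONAL `Θ(n^{2/3})` fan-in rung from the `r = 2` seeds

Teeth `t + a·g + a²·h` (`a < k`, `k = 7` or `8 ≡ n (mod 2)`, `g ≥ 1`, `g + h` odd): consecutive gaps `g + (2a+1)h` are odd, so the comb is even-stretch.  A comb is bad for 2-hub
readers iff some `S_j` holds THREE teeth `a, b, c`; the two difference equations have determinant `(b−a)(c−a)(c−b) ≠ 0`, so (bad comb) ↦ (j, a, b, c, teeth) is injective: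
`#bad ≤ 512·n·f³`, against `≥ (n/2)·(n/56)·(n/196)` combs.  For `f ≤ n^{2/3}/512`, `n ≥ 4096`, a good comb exists. -/
/-- `twoThirdsRoot n = max {m ≤ n : m³ ≤ n²}` (≈ `n^{2/3}`). -/
def twoThirdsRoot (n : ℕ) : ℕ := Nat.findGreatest (fun m => m ^ 3 ≤ n * n) n

/-- FanInRoot helper `twoThirdsRoot_le` (lens-1 g6 FanInRoot package; see the module docstring). -/
theorem twoThirdsRoot_le (n : ℕ) : twoThirdsRoot n ≤ n := Nat.findGreatest_le n

namespace Comb2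

/-- Number of teeth of the comb: the odd value on odd `n`, the even value on even `n` (so that `n − k` is even). -/
def kOf (n : ℕ) : ℕ := if n % 2 = 1 then 7 else 8

/-- FanInRoot helper `kOf_cases` (lens-1 g6 FanInRoot package; see the module docstring). -/
theorem kOf_cases (n : ℕ) : (kOf n = 7 ∧ n % 2 = 1) ∨ (kOf n = 8 ∧ n % 2 = 0) := by
  unfold kOf; by_cases h : n % 2 = 1
  · exact Or.inl ⟨by rw [if_pos h], h⟩
  · exact Or.inr ⟨by rw [if_neg h], by omega⟩

/-- Position of the `a`-th tooth. -/
def pos (t g h a : ℕ) : ℕ := t + a * g + a * a * h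

/-- FanInRoot helper `pos_lt_pos` (lens-1 g6 FanInRoot package; see the module docstring). -/
theorem pos_lt_pos {t g h a b : ℕ} (hg : 0 < g) (hab : a < b) : pos t g h a < pos t g h b := by
  unfold pos
  have h1 : a * g < b * g := Nat.mul_lt_mul_of_pos_right hab hg
  have h2 : a * a * h ≤ b * b * h := Nat.mul_le_mul_right h (Nat.mul_le_mul hab.le hab.le)
  omega

/-- FanInRoot helper `pos_le_pos` (lens-1 g6 FanInRoot package; see the module docstring). -/
theorem pos_le_pos {t g h a b : ℕ} (hab : a ≤ b) : pos t g h a ≤ pos t g h b := by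
  unfold pos
  have h1 : a * g ≤ b * g := Nat.mul_le_mul_right g hab
  have h2 : a * a * h ≤ b * b * h := Nat.mul_le_mul_right h (Nat.mul_le_mul hab hab)
  omega

/-- Parity of the teeth: `pos a ≡ t + a (mod 2)` when `g + h` is odd. -/
theorem pos_add_mod_two {t g h : ℕ} (hgh : (g + h) % 2 = 1) (a b : ℕ) : (pos t g h a + b) % 2 = (t + a + b) % 2 := by
  unfold pos
  obtain ⟨m, rfl | rfl⟩ := Nat.even_or_odd' a
  · have : t + 2 * m * g + 2 * m * (2 * m) * h + b = (t + b) + 2 * (m * g + 2 * m * m * h) := by ring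
    rw [this, Nat.add_mul_mod_self_left]; omega
  · have : t + (2 * m + 1) * g + (2 * m + 1) * (2 * m + 1) * h + b = (t + b + (g + h)) + 2 * (m * g + (2 * m * m + 2 * m) * h) := by ring
    rw [this, Nat.add_mul_mod_self_left]; omega

/-- The comb with the given first tooth and gap parameters, as a set of positions `< n`. -/
def comb (n t g h k : ℕ) : Finset (Fin n) := univ.filter fun i : Fin n => ∃ a, a < k ∧ i.val = pos t g h a

/-- FanInRoot helper `mem_comb` (lens-1 g6 FanInRoot package; see the module docstring). -/
theorem mem_comb {n t g h k : ℕ} {i : Fin n} : i ∈ comb n t g h k ↔ ∃ a, a < k ∧ i.val = pos t g h a := by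
  simp [comb]

/-- The `a`-th tooth of the comb as an element of `Fin n` (needs the non-wrapping hypothesis). -/
def tooth (n t g h k : ℕ) (hlt : pos t g h (k - 1) < n) (a : Fin k) : Fin n :=
  ⟨pos t g h a.val, lt_of_le_of_lt (pos_le_pos (by have := a.isLt; omega)) hlt⟩

/-- FanInRoot helper `tooth_injective` (lens-1 g6 FanInRoot package; see the module docstring). -/
theorem tooth_injective {n t g h k : ℕ} (hlt : pos t g h (k - 1) < n) (hg : 0 < g) : Function.Injective (tooth n t g h k hlt) := by
  intro a b hab
  simp only [tooth, Fin.mk.injEq] at hab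
  rcases lt_trichotomy a.val b.val with hlt' | heq | hgt
  · exact absurd hab (pos_lt_pos hg hlt').ne
  · exact Fin.ext heq
  · exact absurd hab.symm (pos_lt_pos hg hgt).ne

/-- FanInRoot helper `comb_eq_image` (lens-1 g6 FanInRoot package; see the module docstring). -/
theorem comb_eq_image {n t g h k : ℕ} (hlt : pos t g h (k - 1) < n) : comb n t g h k = univ.image (tooth n t g h k hlt) := by
  ext i
  simp only [mem_comb, mem_image, mem_univ, true_and]
  constructor
  · rintro ⟨a, ha, hi⟩; exact ⟨⟨a, ha⟩, Fin.ext (by simp [tooth, hi])⟩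
  · rintro ⟨a, rfl⟩; exact ⟨a.val, a.isLt, rfl⟩

/-- FanInRoot helper `card_comb` (lens-1 g6 FanInRoot package; see the module docstring). -/
theorem card_comb {n t g h k : ℕ} (hlt : pos t g h (k - 1) < n) (hg : 0 < g) : (comb n t g h k).card = k := by
  rw [comb_eq_image hlt, card_image_of_injective _ (tooth_injective hlt hg), card_univ, Fintype.card_fin]

/-- FanInRoot helper `card_comb_filter_lt` (lens-1 g6 FanInRoot package; see the module docstring). -/
theorem card_comb_filter_lt {n t g h k : ℕ} (hlt : pos t g h (k - 1) < n) (hg : 0 < g) (a' : Fin k) :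
    ((comb n t g h k).filter fun i => i < tooth n t g h k hlt a').card = a'.val := by
  rw [comb_eq_image hlt, Finset.filter_image, card_image_of_injective _ (tooth_injective hlt hg)]
  have : (univ.filter fun a : Fin k => tooth n t g h k hlt a < tooth n t g h k hlt a') = Finset.Iio a' := by
    ext a
    simp only [mem_filter, mem_univ, true_and, Finset.mem_Iio, tooth, Fin.lt_def]
    constructor
    · intro h'; by_contra hle; push Not at hle
      exact absurd h' (not_lt.2 (pos_le_pos hle))
    · intro h'; exact pos_lt_pos hg h'
  rw [this, Fin.card_Iio]

/-- Quadratic combs with `g ≥ 1`, `g + h` odd and `k ≡ n (mod 2)` teeth are even-stretch. -/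
theorem evenStretch_comb {n t g h k : ℕ} (hlt : pos t g h (k - 1) < n) (hg : 0 < g) (hgh : (g + h) % 2 = 1) (hkn : (n - k) % 2 = 0) :
    comb n t g h k ∈ EvenStretch n := by
  refine ⟨by rw [card_comb hlt hg]; exact hkn, ?_⟩
  intro i hi i' hi'
  rw [comb_eq_image hlt] at hi hi'
  simp only [mem_image, mem_univ, true_and] at hi hi'
  obtain ⟨a, rfl⟩ := hi
  obtain ⟨a', rfl⟩ := hi'
  rw [card_comb_filter_lt hlt hg a', card_comb_filter_lt hlt hg a]
  simp only [tooth]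
  rw [pos_add_mod_two hgh, pos_add_mod_two hgh]; congr 1; ring

/-- FanInRoot helper `twoThirdsRoot_pow_le` (lens-1 g6 FanInRoot package; see the module docstring). -/
theorem twoThirdsRoot_pow_le (n : ℕ) : twoThirdsRoot n ^ 3 ≤ n * n := by
  unfold twoThirdsRoot
  exact Nat.findGreatest_spec (P := fun m => m ^ 3 ≤ n * n) (Nat.zero_le n) (by simp)

/-- FanInRoot helper `cube_bound` (lens-1 g6 FanInRoot package; see the module docstring). -/
theorem cube_bound (n : ℕ) : 2 ^ 27 * (twoThirdsRoot n / 512) ^ 3 ≤ n * n := by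
  have h1 : 512 * (twoThirdsRoot n / 512) ≤ twoThirdsRoot n := Nat.mul_div_le _ 512
  calc 2 ^ 27 * (twoThirdsRoot n / 512) ^ 3 = (512 * (twoThirdsRoot n / 512)) ^ 3 := by ring
    _ ≤ twoThirdsRoot n ^ 3 := Nat.pow_le_pow_left h1 3
    _ ≤ n * n := twoThirdsRoot_pow_le n

/-- The VANDERMONDE step: three teeth determine the quadratic comb. -/
theorem comb_determined {t g h t' g' h' a b c P Q R : ℕ} (hab : a ≠ b) (hac : a ≠ c) (hbc : b ≠ c)
    (e1 : P = pos t g h a) (e1' : P = pos t' g' h' a) (e2 : Q = pos t g h b) (e2' : Q = pos t' g' h' b)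
    (e3 : R = pos t g h c) (e3' : R = pos t' g' h' c) : t = t' ∧ g = g' ∧ h = h' := by
  unfold pos at *
  have E1 : (t : ℤ) + a * g + a * a * h = t' + a * g' + a * a * h' := by exact_mod_cast e1.symm.trans e1'
  have E2 : (t : ℤ) + b * g + b * b * h = t' + b * g' + b * b * h' := by exact_mod_cast e2.symm.trans e2'
  have E3 : (t : ℤ) + c * g + c * c * h = t' + c * g' + c * c * h' := by exact_mod_cast e3.symm.trans e3'
  have F12 : ((b : ℤ) - a) * (((g : ℤ) - g') + ((a : ℤ) + b) * ((h : ℤ) - h')) = 0 := by linear_combination E2 - E1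
  have F13 : ((c : ℤ) - a) * (((g : ℤ) - g') + ((a : ℤ) + c) * ((h : ℤ) - h')) = 0 := by linear_combination E3 - E1
  have hba : ((b : ℤ) - a) ≠ 0 := sub_ne_zero.2 (by exact_mod_cast hab.symm)
  have hca : ((c : ℤ) - a) ≠ 0 := sub_ne_zero.2 (by exact_mod_cast hac.symm)
  have X12 := (mul_eq_zero.1 F12).resolve_left hba
  have X13 := (mul_eq_zero.1 F13).resolve_left hca
  have F : ((c : ℤ) - b) * ((h : ℤ) - h') = 0 := by linear_combination X13 - X12
  have hcb : ((c : ℤ) - b) ≠ 0 := sub_ne_zero.2 (by exact_mod_cast hbc.symm)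
  have Hh : (h : ℤ) = h' := by have := (mul_eq_zero.1 F).resolve_left hcb; omega
  have Hg : (g : ℤ) = g' := by rw [Hh, sub_self, mul_zero, add_zero] at X12; omega
  have Ht : (t : ℤ) = t' := by rw [Hg, Hh] at E1; linarith
  exact ⟨by exact_mod_cast Ht, by exact_mod_cast Hg, by exact_mod_cast Hh⟩

/-- **QUADRATIC COMB SELECTION THEOREM.**  For `n ≥ 4096`, against reading sets of size `≤ n^{2/3}/512` there is an admissible quadratic comb with `kOf n ∈ {7,8}` teeth
met at most twice by every reading set. -/
theorem comb_select (n : ℕ) (hn : 4096 ≤ n) (S : Fin n → Finset (Fin n)) (hS : ∀ j, (S j).card ≤ twoThirdsRoot n / 512) :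
    ∃ t g h : ℕ, 0 < g ∧ (g + h) % 2 = 1 ∧ pos t g h (kOf n - 1) < n ∧ ∀ j, (S j ∩ comb n t g h (kOf n)).card ≤ 2 := by
  set k := kOf n with hkdef
  set f := twoThirdsRoot n / 512 with hfdef
  have hk : k = 7 ∨ k = 8 := by rcases kOf_cases n with ⟨h, -⟩ | ⟨h, -⟩ <;> simp [hkdef, h]
  have hk8 : k ≤ 8 := by omega
  let T : Finset ℕ := Finset.range (n / 2)
  let GH : Finset (ℕ × ℕ) := ((Finset.range (n / 28 + 1)) ×ˢ (Finset.range (n / 196 + 1))).filter fun gh => 1 ≤ gh.1 ∧ (gh.1 + gh.2) % 2 = 1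
  let D : Finset (ℕ × (ℕ × ℕ)) := T ×ˢ GH
  have hD_ok : ∀ p ∈ D, 0 < p.2.1 ∧ (p.2.1 + p.2.2) % 2 = 1 ∧ pos p.1 p.2.1 p.2.2 (k - 1) < n := by
    intro p hp
    simp only [D, T, GH, mem_product, mem_range, mem_filter] at hp
    obtain ⟨ht, ⟨hg, hh⟩, hg1, hpar⟩ := hp
    refine ⟨hg1, hpar, ?_⟩
    unfold pos
    have h1 : (k - 1) * p.2.1 ≤ 7 * p.2.1 := Nat.mul_le_mul_right _ (by omega)
    have h49 : (k - 1) * (k - 1) ≤ 7 * 7 := Nat.mul_le_mul (by omega : k - 1 ≤ 7) (by omega : k - 1 ≤ 7)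
    have h2 : (k - 1) * (k - 1) * p.2.2 ≤ 49 * p.2.2 := Nat.mul_le_mul_right _ h49
    omega
  by_contra hnone
  push Not at hnone
  have hbad : ∀ p ∈ D, ∃ w : Fin n × Fin 8 × Fin 8 × Fin 8 × Fin n × Fin n × Fin n,
      w.2.2.2.2.1 ∈ S w.1 ∧ w.2.2.2.2.2.1 ∈ S w.1 ∧ w.2.2.2.2.2.2 ∈ S w.1 ∧
      w.2.1.val ≠ w.2.2.1.val ∧ w.2.1.val ≠ w.2.2.2.1.val ∧ w.2.2.1.val ≠ w.2.2.2.1.val ∧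
      w.2.2.2.2.1.val = pos p.1 p.2.1 p.2.2 w.2.1.val ∧ w.2.2.2.2.2.1.val = pos p.1 p.2.1 p.2.2 w.2.2.1.val ∧
      w.2.2.2.2.2.2.val = pos p.1 p.2.1 p.2.2 w.2.2.2.1.val := by
    intro p hp
    obtain ⟨hg0, hpar, hlt⟩ := hD_ok p hp
    obtain ⟨j, hj⟩ := hnone p.1 p.2.1 p.2.2 hg0 hpar hlt
    obtain ⟨i₁, i₂, i₃, h₁, h₂, h₃, h12, h13, h23⟩ := Finset.two_lt_card_iff.1 hj
    obtain ⟨hi₁, hc₁⟩ := Finset.mem_inter.1 h₁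
    obtain ⟨hi₂, hc₂⟩ := Finset.mem_inter.1 h₂
    obtain ⟨hi₃, hc₃⟩ := Finset.mem_inter.1 h₃
    obtain ⟨a, ha, hia⟩ := mem_comb.1 hc₁
    obtain ⟨b, hb, hib⟩ := mem_comb.1 hc₂
    obtain ⟨c, hc, hic⟩ := mem_comb.1 hc₃
    refine ⟨(j, ⟨a, by omega⟩, ⟨b, by omega⟩, ⟨c, by omega⟩, i₁, i₂, i₃), hi₁, hi₂, hi₃, ?_, ?_, ?_, hia, hib, hic⟩
    · rintro (hab : a = b); exact h12 (Fin.ext (by rw [hia, hib, hab]))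
    · rintro (hac : a = c); exact h13 (Fin.ext (by rw [hia, hic, hac]))
    · rintro (hbc : b = c); exact h23 (Fin.ext (by rw [hib, hic, hbc]))
  haveI : Nonempty (Fin n × Fin 8 × Fin 8 × Fin 8 × Fin n × Fin n × Fin n) :=
    ⟨(⟨0, by omega⟩, 0, 0, 0, ⟨0, by omega⟩, ⟨0, by omega⟩, ⟨0, by omega⟩)⟩
  choose! Ψ hΨ using hbad
  let W : Finset (Fin n × Fin 8 × Fin 8 × Fin 8 × Fin n × Fin n × Fin n) :=
    (univ : Finset (Fin n × Fin 8 × Fin 8 × Fin 8)).biUnion fun q =>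
      (((S q.1) ×ˢ (S q.1)) ×ˢ (S q.1)).image fun iii => (q.1, q.2.1, q.2.2.1, q.2.2.2, iii.1.1, iii.1.2, iii.2)
  have hmaps : ∀ p ∈ D, Ψ p ∈ W := by
    intro p hp
    obtain ⟨h1, h2, h3, -⟩ := hΨ p hp
    rw [Finset.mem_biUnion]
    refine ⟨((Ψ p).1, (Ψ p).2.1, (Ψ p).2.2.1, (Ψ p).2.2.2.1), mem_univ _, ?_⟩
    rw [Finset.mem_image]
    exact ⟨(((Ψ p).2.2.2.2.1, (Ψ p).2.2.2.2.2.1), (Ψ p).2.2.2.2.2.2),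
      Finset.mem_product.2 ⟨Finset.mem_product.2 ⟨h1, h2⟩, h3⟩, rfl⟩
  have hinj : Set.InjOn Ψ D := by
    intro p hp p' hp' heq
    obtain ⟨-, -, -, hab, hac, hbc, e1, e2, e3⟩ := hΨ p hp
    obtain ⟨-, -, -, -, -, -, e1', e2', e3'⟩ := hΨ p' hp'
    rw [heq] at hab hac hbc e1 e2 e3
    obtain ⟨ht, hg, hh⟩ := comb_determined hab hac hbc e1 e1' e2 e2' e3 e3'
    exact Prod.ext ht (Prod.ext hg hh)
  have hcard : D.card ≤ W.card := Finset.card_le_card_of_injOn Ψ hmaps hinj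
  have hW : W.card ≤ n * 512 * f ^ 3 := by
    calc W.card ≤ ∑ q : Fin n × Fin 8 × Fin 8 × Fin 8, ((((S q.1) ×ˢ (S q.1)) ×ˢ (S q.1)).image fun iii => (q.1, q.2.1, q.2.2.1, q.2.2.2, iii.1.1, iii.1.2, iii.2)).card :=
          Finset.card_biUnion_le
      _ ≤ ∑ q : Fin n × Fin 8 × Fin 8 × Fin 8, f ^ 3 := Finset.sum_le_sum fun q _ => by
          refine le_trans Finset.card_image_le ?_
          rw [Finset.card_product, Finset.card_product]
          calc (S q.1).card * (S q.1).card * (S q.1).card ≤ f * f * f := Nat.mul_le_mul (Nat.mul_le_mul (hS _) (hS _)) (hS _)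
            _ = f ^ 3 := by ring
      _ = n * 512 * f ^ 3 := by
          rw [Finset.sum_const, Finset.card_univ, smul_eq_mul, Fintype.card_prod, Fintype.card_prod, Fintype.card_prod, Fintype.card_fin, Fintype.card_fin]
  have hDcard : D.card = (n / 2) * GH.card := by simp [D, T, Finset.card_product]
  have hGH : (n / 28 / 2) * (n / 196 + 1) ≤ GH.card := by
    have : ((Finset.range (n / 28 / 2)) ×ˢ (Finset.range (n / 196 + 1))).card ≤ GH.card := by
      refine Finset.card_le_card_of_injOn (fun ih => (2 * ih.1 + 1 + ih.2 % 2, ih.2)) (fun ih hih => ?_) (fun ih _ ih' _ h => ?_)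
      · simp only [GH, mem_product, mem_range, mem_filter, Finset.mem_coe] at hih ⊢
        omega
      · simp only [Prod.mk.injEq] at h
        exact Prod.ext (by omega) h.2
    simpa [Finset.card_product] using this
  have hf : 2 ^ 27 * f ^ 3 ≤ n * n := cube_bound n
  -- final count, through q = n / 4096
  set q := n / 4096 with hqdef
  have hq : 1 ≤ q := by omega
  have hX : 2 ^ 18 * (n * 512 * f ^ 3) ≤ n ^ 3 := by
    calc 2 ^ 18 * (n * 512 * f ^ 3) = n * (2 ^ 27 * f ^ 3) := by ring
      _ ≤ n * (n * n) := Nat.mul_le_mul_left n hf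
      _ = n ^ 3 := by ring
  have hN : n ^ 3 < 2 ^ 36 * (q + 1) ^ 3 := by
    have h1 : n < 4096 * (q + 1) := by omega
    calc n ^ 3 < (4096 * (q + 1)) ^ 3 := Nat.pow_lt_pow_left h1 (by norm_num)
      _ = 2 ^ 36 * (q + 1) ^ 3 := by ring
  have hC : (q + 1) ^ 3 ≤ 8 * q ^ 3 := by
    calc (q + 1) ^ 3 ≤ (2 * q) ^ 3 := Nat.pow_le_pow_left (by omega) 3
      _ = 8 * q ^ 3 := by ring
  have hY : 2990080 * q ^ 3 ≤ (n / 2) * GH.card := by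
    have hA : 2048 * q ≤ n / 2 := by omega
    have hB : 73 * q ≤ n / 28 / 2 := by omega
    have hC' : 20 * q ≤ n / 196 + 1 := by omega
    calc 2990080 * q ^ 3 = (2048 * q) * ((73 * q) * (20 * q)) := by ring
      _ ≤ (n / 2) * ((n / 28 / 2) * (n / 196 + 1)) := Nat.mul_le_mul hA (Nat.mul_le_mul hB hC')
      _ ≤ (n / 2) * GH.card := Nat.mul_le_mul_left _ hGH
  have hlt : n * 512 * f ^ 3 < D.card := by rw [hDcard]; linarith
  omega

end Comb2

/-! ### The TABLE LAW `r = 2` and the `Θ(n^{2/3})` FAN-IN RUNG -/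

/-- **TABLE LAW, `r = 2`:** every even-stretch configuration of 7 or 8 hubs defeats two-hub readers. -/
theorem hubLoses_two {n : ℕ} (H : Finset (Fin n)) (hE : H ∈ EvenStretch n) (h78 : H.card = 7 ∨ H.card = 8) : H ∈ HubLoses n 2 := by
  refine hubLoses_of_hubLosesDeg (collapseLaw3 n 2 H hE (by omega) ?_)
  rcases h78 with h | h
  · rw [h]; exact smallRingLosesDeg_7_2
  · rw [h]; exact smallRingLosesDeg_8_2

/-- **THEOREM (UNCONDITIONAL, DEGREE-FREE).**  On `C_n`, `n ≥ 4096`, NO strategy all of whose outputs read at most `n^{2/3}/512` inputs is perfect on the odd class. -/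
theorem noPerfectFanInAll_twoThirdsRoot : (fun n => twoThirdsRoot n / 512) ∈ NoPerfectFanInAll := by
  refine ⟨4096, fun n hn z hz => ?_⟩
  choose S hS using hz
  obtain ⟨t, g, h, hg0, hgh, hlt, hmeet⟩ := Comb2.comb_select n hn S fun j => (hS j).1
  have hkn : (n - Comb2.kOf n) % 2 = 0 := by
    rcases Comb2.kOf_cases n with ⟨hk, hn2⟩ | ⟨hk, hn2⟩ <;> rw [hk] <;> omega
  have hE : Comb2.comb n t g h (Comb2.kOf n) ∈ EvenStretch n := Comb2.evenStretch_comb hlt hg0 hgh hkn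
  have h78 : (Comb2.comb n t g h (Comb2.kOf n)).card = 7 ∨ (Comb2.comb n t g h (Comb2.kOf n)).card = 8 := by
    rw [Comb2.card_comb hlt hg0]
    rcases Comb2.kOf_cases n with ⟨hk, -⟩ | ⟨hk, -⟩
    · exact Or.inl hk
    · exact Or.inr hk
  obtain ⟨x, -, hox, hrel⟩ := hubLoses_two _ hE h78 z fun j =>
    ⟨S j ∩ Comb2.comb n t g h (Comb2.kOf n), Finset.inter_subset_right, hmeet j,
      fun x x' hx hx' hR => dep_on_hubs (hS j).2 x x' hx hx' hR⟩
  exact ⟨x, hox, hrel⟩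

/-- **RUNG R⅔′:** no perfect constant-degree strategy with all fan-ins `≤ n^{2/3}/512`. -/
theorem noPerfectFanInTwoThirdsRoot3 : (fun n => twoThirdsRoot n / 512) ∈ NoPerfectFanIn3 := noPerfectFanIn3_of_all noPerfectFanInAll_twoThirdsRoot

end Summit.QuantumAdvantage.QuantumAdvantage.Theorems.FanInRoot
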